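import Literature.AnabelianGeometry.SemiGraphs.CovObjOfGraphCovering
import HarnessLib

/-!
# [SemiAnbd] Rmk 3.5.1 for SEMI-graphs: the locally trivial covering object `S_π ∈ B^cov(G)` of a proper excision
# `π : 𝔾′ → 𝔾_G` (`𝔾′` any semi-graph — open edges allowed), and `𝔾′ ≅ 𝔾_{S_π}` over `𝔾_G`

Mochizuki, *Semi-graphs of anabelioids*, Publ. RIMS **42** (2006), §1 p. 11 (proper morphisms preserve verticial
cardinalities), p. 14 (graph-coverings = proper excisions), §3 Rmk 3.5.1 p. 37 («locally trivial covering … ⟷ graph-covering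
with countable fibers of the semi-graph `𝔾`»), Def 3.5 (i) p. 37 (kurims `paper:url-f33ace170ff4`).
[cite: MochizukiSemiAnbd2006, Rmk 3.5.1 p.37]

abc-iut cell, layer L3, seat abc-iut-f-161 gen 8, row «PROP46⟸PULLBACK+P44i» stage 2 FILE C′.  The sibling constructor
`CovObj.ofGraphCovering` (this seat, `CovObjOfGraphCovering.lean`) uses abc-iut-L3-t1's branch bijection
`SemiGraph.Hom.fiberEquivOfBranch`, stated for a GRAPH source `𝔾′`; but the finite objects of `Loc(𝔾, Γ)` (links!) have OPEN edges,
so the graph-covering `K′ → K` of Prop 4.4 (i) / Thm 1.2 (ii) is a covering of SEMI-graphs.  Here the source hypothesis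
«`𝔾′` a graph» is replaced by «`π` PROPER» (every graph-covering is): over a proper `π`, the branch of an edge `e′` lying over an
ABUTTING branch `b` abuts (abc-iut-L3-t1's `SemiGraph.exists_branch_preimage_abuts`, `ProperBranchLifting`), which is all the
branch bijection needs.  DEFINITIONS + bookkeeping:
* `SemiGraph.Hom.vertexOverOfProper`, `fiberEquivOfBranchOfProper` — the branch bijection `π⁻¹(v) ≃ π⁻¹(e)` of §1 p.14 for a
  proper excision from a SEMI-graph;
* **`CovObj.ofSemiGraphCovering π hexc hprop`** — fibres with trivial actions (this seat's `BTemp.trivialOn`), glued by that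
  bijection; `…_isLocallyTrivial`, `…_isFinite`, `…_glue_apply`, `…_glueCondition` (tautological points), bijective point lift,
  **`ofSemiGraphCovering_graphIso : 𝔾′ ≅ 𝔾_{S_π}` over `𝔾_G`** (`…_hom_comp`).
Nothing printed is asserted; no side taken on [IUTchIII] Cor. 3.12.
-/

noncomputable section

namespace Literature.AnabelianGeometry.SemiGraphs

open CategoryTheory
open Literature.AlgebraicGeometry.Frobenioids.QuasiTemperoid.BTempConnected (hom_ρ ρ_one_apply
  ρ_mul_apply ρ_inv_apply)

universe u

/-! ## The branch bijection of a proper excision from a semi-graph -/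

namespace SemiGraph

variable {G G' : SemiGraph.{u}} {ψ : G' ⟶ G}

/-- Over a PROPER `ψ`, the branch of an edge `e′` lying over a branch `b` that ABUTS (to `v`) abuts: by branch lifting
(`exists_branch_preimage_abuts`) some branch of `e′` over `b` abuts, and it is THE branch of `e′` over `b`.
[cite: MochizukiSemiAnbd2006, §1 p.11] -/
theorem Hom.abuts_branchOver_isSome_of_isProper (hψ : IsProper ψ) (b : G.Branch) (v : G.Vertex)
    (h : G.abuts b = some v) (e' : ψ.EdgeFiber (G.edgeOf b)) : (G'.abuts (Hom.branchOver b e')).isSome := by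
  obtain ⟨b'', v', hb''e, hb''b, hb''v, -⟩ := exists_branch_preimage_abuts ψ hψ e'.1 b e'.2.symm v h
  have hbb : b'' = Hom.branchOver b e' :=
    Hom.branch_eq_of_edgeOf_eq_of_branchMap_eq (ψ := ψ) (by rw [hb''e, Hom.edgeOf_branchOver])
      (by rw [hb''b, Hom.branchMap_branchOver])
  rw [← hbb, hb''v]
  rfl

/-- The vertex of `𝔾′` to which the branch of `e′` over the abutting branch `b` abuts (proper `ψ`).
[cite: MochizukiSemiAnbd2006, §1 p.11] -/
noncomputable def Hom.vertexOverOfProper (hψ : IsProper ψ) (b : G.Branch) (v : G.Vertex) (h : G.abuts b = some v)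
    (e' : ψ.EdgeFiber (G.edgeOf b)) : G'.Vertex :=
  (G'.abuts (Hom.branchOver b e')).get (Hom.abuts_branchOver_isSome_of_isProper hψ b v h e')

/-- The branch of `e′` over `b` abuts to `vertexOverOfProper`. [cite: MochizukiSemiAnbd2006, §1 p.11] -/
theorem Hom.abuts_branchOver_of_isProper (hψ : IsProper ψ) (b : G.Branch) (v : G.Vertex) (h : G.abuts b = some v)
    (e' : ψ.EdgeFiber (G.edgeOf b)) :
    G'.abuts (Hom.branchOver b e') = some (Hom.vertexOverOfProper hψ b v h e') := by
  simp [Hom.vertexOverOfProper]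

/-- `vertexOverOfProper` lies over `v`. [cite: MochizukiSemiAnbd2006, §1 p.11] -/
theorem Hom.vertexMap_vertexOverOfProper (hψ : IsProper ψ) (b : G.Branch) (v : G.Vertex) (h : G.abuts b = some v)
    (e' : ψ.EdgeFiber (G.edgeOf b)) : ψ.vertexMap (Hom.vertexOverOfProper hψ b v h e') = v := by
  have h1 := ψ.abuts_branchMap _ _ (Hom.abuts_branchOver_of_isProper hψ b v h e')
  rw [Hom.branchMap_branchOver, h] at h1
  exact (Option.some_injective _ h1).symm

/-- **The branch bijection `π⁻¹(v) ≃ π⁻¹(e)` of §1 p.14 for a PROPER EXCISION from a SEMI-graph** (cf. abc-iut-L3-t1's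
`fiberEquivOfBranch` for a graph source): `v′ ↦` the edge of the branch over `b` at `v′`; inverse `e′ ↦` the vertex receiving the
branch of `e′` over `b`. [cite: MochizukiSemiAnbd2006, §1 p.14] -/
noncomputable def Hom.fiberEquivOfBranchOfProper (hψ : IsExcision ψ) (hp : IsProper ψ) (b : G.Branch) (v : G.Vertex)
    (h : G.abuts b = some v) : ψ.VertexFiber v ≃ ψ.EdgeFiber (G.edgeOf b) where
  toFun v' := ⟨G'.edgeOf (Hom.branchLift hψ b v h v').1, Hom.edgeMap_edgeOf_branchLift hψ b v h v'⟩
  invFun e' := ⟨Hom.vertexOverOfProper hp b v h e', Hom.vertexMap_vertexOverOfProper hp b v h e'⟩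
  left_inv v' := by
    -- adapted from abc-iut-L3-t1's `fiberEquivOfBranch` (`GraphCoveringFibres.lean`, same cell)
    apply Subtype.ext
    have hb : Hom.branchOver b ⟨G'.edgeOf (Hom.branchLift hψ b v h v').1,
        Hom.edgeMap_edgeOf_branchLift hψ b v h v'⟩ = (Hom.branchLift hψ b v h v').1 :=
      Hom.branch_eq_of_edgeOf_eq_of_branchMap_eq (ψ := ψ) (by simp) (by simp)
    have h2 := Hom.abuts_branchOver_of_isProper hp b v h ⟨G'.edgeOf (Hom.branchLift hψ b v h v').1,
        Hom.edgeMap_edgeOf_branchLift hψ b v h v'⟩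
    rw [hb, Hom.abuts_branchLift] at h2
    exact (Option.some_injective _ h2).symm
  right_inv e' := by
    apply Subtype.ext
    have hb : Hom.branchOver b e' = (Hom.branchLift hψ b v h
        ⟨Hom.vertexOverOfProper hp b v h e', Hom.vertexMap_vertexOverOfProper hp b v h e'⟩).1 :=
      Hom.eq_branchLift hψ b v h _ _ (Hom.abuts_branchOver_of_isProper hp b v h e') (Hom.branchMap_branchOver b e')
    change G'.edgeOf (Hom.branchLift hψ b v h _).1 = e'.1
    rw [← hb, Hom.edgeOf_branchOver]

/-- The inverse branch bijection, evaluated. [cite: MochizukiSemiAnbd2006, §1 p.14] -/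
theorem Hom.fiberEquivOfBranchOfProper_symm_apply_val (hψ : IsExcision ψ) (hp : IsProper ψ) (b : G.Branch)
    (v : G.Vertex) (h : G.abuts b = some v) (e' : ψ.EdgeFiber (G.edgeOf b)) :
    ((Hom.fiberEquivOfBranchOfProper hψ hp b v h).symm e').1 = Hom.vertexOverOfProper hp b v h e' := rfl

/-- For the abutting branch `b′ : e′ → w` itself: the branch of `e(b′)` over `ψ b′` is `b′`, so `vertexOverOfProper` is `w`.
[cite: MochizukiSemiAnbd2006, §1 p.11] -/
theorem Hom.vertexOverOfProper_eq_of_abuts (hp : IsProper ψ) (b' : G'.Branch) (w : G'.Vertex) (h' : G'.abuts b' = some w)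
    (v : G.Vertex) (h : G.abuts (ψ.branchMap b') = some v)
    (x : ψ.EdgeFiber (G.edgeOf (ψ.branchMap b'))) (hx : x.1 = G'.edgeOf b') :
    Hom.vertexOverOfProper hp (ψ.branchMap b') v h x = w := by
  have hb : Hom.branchOver (ψ.branchMap b') x = b' :=
    Hom.branch_eq_of_edgeOf_eq_of_branchMap_eq (ψ := ψ) (by rw [Hom.edgeOf_branchOver, hx])
      (by rw [Hom.branchMap_branchOver])
  have h2 := Hom.abuts_branchOver_of_isProper hp (ψ.branchMap b') v h x
  rw [hb, h'] at h2
  exact (Option.some_injective _ h2).symm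

end SemiGraph

namespace ProfiniteSemiGraph

namespace CovObj

variable {K : ProfiniteSemiGraph.{u}} {B' : SemiGraph.{u}} (π : B' ⟶ K.graph) (hexc : SemiGraph.IsExcision π)
  (hprop : SemiGraph.IsProper π)
  [∀ v, Countable (SemiGraph.Hom.VertexFiber π v)] [∀ e, Countable (SemiGraph.Hom.EdgeFiber π e)]

/-! ## The locally trivial covering object of a proper excision (Rmk 3.5.1, semi-graph source) -/

/-- **`S_π ∈ B^cov(G)` of a proper excision `π : 𝔾′ → 𝔾_G` from a SEMI-graph**: `S_v := π⁻¹(v)`, `S_e := π⁻¹(e)` with trivial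
actions, glued along an abutting branch `b : e → v` by the inverse branch bijection `π⁻¹(e) ≃ π⁻¹(v)`.
[cite: MochizukiSemiAnbd2006, Rmk 3.5.1 p.37] -/
def ofSemiGraphCovering : CovObj K where
  SV v := BTemp.trivialOn (K.Gv v) (SemiGraph.Hom.VertexFiber π v)
  SE e := BTemp.trivialOn (K.Ge e) (SemiGraph.Hom.EdgeFiber π e)
  glue b v h := BTemp.isoOfEquiv (SemiGraph.Hom.fiberEquivOfBranchOfProper hexc hprop b v h).symm fun _ _ => rfl

/-- The vertex fibres of `S_π` are the fibres of `π`. [cite: MochizukiSemiAnbd2006, Rmk 3.5.1 p.37] -/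
@[simp] theorem ofSemiGraphCovering_SV (v : K.graph.Vertex) :
    (ofSemiGraphCovering π hexc hprop).SV v = BTemp.trivialOn (K.Gv v) (SemiGraph.Hom.VertexFiber π v) := rfl

/-- The edge fibres of `S_π` are the fibres of `π`. [cite: MochizukiSemiAnbd2006, Rmk 3.5.1 p.37] -/
@[simp] theorem ofSemiGraphCovering_SE (e : K.graph.Edge) :
    (ofSemiGraphCovering π hexc hprop).SE e = BTemp.trivialOn (K.Ge e) (SemiGraph.Hom.EdgeFiber π e) := rfl

/-- The gluing of `S_π` on points. [cite: MochizukiSemiAnbd2006, Rmk 3.5.1 p.37] -/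
theorem ofSemiGraphCovering_glue_apply (b : K.graph.Branch) (v : K.graph.Vertex) (h : K.graph.abuts b = some v)
    (x : SemiGraph.Hom.EdgeFiber π (K.graph.edgeOf b)) :
    ((ofSemiGraphCovering π hexc hprop).glue b v h).hom.hom.hom x =
      (SemiGraph.Hom.fiberEquivOfBranchOfProper hexc hprop b v h).symm x :=
  rfl

/-- **`S_π` is locally trivial.** [cite: MochizukiSemiAnbd2006, Rmk 3.5.1 p.37] -/
theorem ofSemiGraphCovering_isLocallyTrivial : (ofSemiGraphCovering π hexc hprop).IsLocallyTrivial :=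
  ⟨fun _ _ _ => rfl, fun _ _ _ => rfl⟩

/-- `S_π` is finite when the fibres of `π` are. [cite: MochizukiSemiAnbd2006, §3 p.37] -/
theorem ofSemiGraphCovering_isFinite (hV : ∀ v, Finite (SemiGraph.Hom.VertexFiber π v))
    (hE : ∀ e, Finite (SemiGraph.Hom.EdgeFiber π e)) : (ofSemiGraphCovering π hexc hprop).IsFinite :=
  ⟨fun v => hV v, fun e => hE e⟩

/-! ## `𝔾_{S_π} ≅ 𝔾′` over `𝔾_G` -/

/-- Transport along an equality of edges keeps the underlying edge. [cite: MochizukiSemiAnbd2006, Def 3.5(i) p.37] -/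
theorem ofSemiGraphCovering_castPtE_val {e₁ e₂ : K.graph.Edge} (h : e₁ = e₂) (t : SemiGraph.Hom.EdgeFiber π e₁) :
    ((ofSemiGraphCovering π hexc hprop).castPtE h t).1 = t.1 := by
  subst h; rfl

/-- **Gluing condition for the tautological point system of `π`** (`y_w := ⟨w, rfl⟩`, `z_{e′} := ⟨e′, rfl⟩`).
[cite: MochizukiSemiAnbd2006, Def 3.5(i) p.37] -/
theorem ofSemiGraphCovering_glueCondition :
    (ofSemiGraphCovering π hexc hprop).GlueCondition π (fun w => ⟨w, rfl⟩) (fun e' => ⟨e', rfl⟩) := by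
  refine ⟨fun b' w h' => ?_⟩
  congr 1
  rw [ofSemiGraphCovering_glue_apply]
  apply Subtype.ext
  rw [SemiGraph.Hom.fiberEquivOfBranchOfProper_symm_apply_val]
  exact SemiGraph.Hom.vertexOverOfProper_eq_of_abuts hprop b' w h' _ _ _
    (by rw [ofSemiGraphCovering_castPtE_val])

/-- The point lift `𝔾′ → 𝔾_{S_π}` is bijective on vertices. [cite: MochizukiSemiAnbd2006, §2 p.23] -/
theorem ofSemiGraphCovering_pointLift_vertexMap_bijective :
    Function.Bijective ((ofSemiGraphCovering π hexc hprop).pointLift π (fun w => ⟨w, rfl⟩) (fun e' => ⟨e', rfl⟩)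
      (ofSemiGraphCovering_glueCondition π hexc hprop)).vertexMap := by
  constructor
  · intro w₁ w₂ h
    have := congrArg (fun ν : (ofSemiGraphCovering π hexc hprop).coveringSemiGraph.Vertex => (Quot.out ν.2).1) h
    simpa only [pointLift_vertexMap, ofSemiGraphCovering_SV, BTemp.out_cl_trivialOn] using this
  · rintro ⟨v, o⟩
    induction o using Quot.ind with
    | mk t =>
      obtain ⟨w, rfl⟩ := t
      exact ⟨w, rfl⟩

/-- … and on edges. [cite: MochizukiSemiAnbd2006, §2 p.23] -/
theorem ofSemiGraphCovering_pointLift_edgeMap_bijective :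
    Function.Bijective ((ofSemiGraphCovering π hexc hprop).pointLift π (fun w => ⟨w, rfl⟩) (fun e' => ⟨e', rfl⟩)
      (ofSemiGraphCovering_glueCondition π hexc hprop)).edgeMap := by
  constructor
  · intro e₁ e₂ h
    have := congrArg (fun ε : (ofSemiGraphCovering π hexc hprop).coveringSemiGraph.Edge => (Quot.out ε.2).1) h
    simpa only [pointLift_edgeMap, ofSemiGraphCovering_SE, BTemp.out_cl_trivialOn] using this
  · rintro ⟨e, o⟩
    induction o using Quot.ind with
    | mk t =>
      obtain ⟨e', rfl⟩ := t
      exact ⟨e', rfl⟩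

/-- **`𝔾′ ≅ 𝔾_{S_π}`** for a proper excision from a semi-graph (a graph-covering): the point lift is an isomorphism.
[cite: MochizukiSemiAnbd2006, Rmk 3.5.1 p.37] -/
def ofSemiGraphCovering_graphIso : B' ≅ (ofSemiGraphCovering π hexc hprop).coveringSemiGraph :=
  (ofSemiGraphCovering π hexc hprop).pointLiftIso π (fun w => ⟨w, rfl⟩) (fun e' => ⟨e', rfl⟩)
    (ofSemiGraphCovering_glueCondition π hexc hprop) hprop (ofSemiGraphCovering_pointLift_vertexMap_bijective π hexc hprop)
    (ofSemiGraphCovering_pointLift_edgeMap_bijective π hexc hprop)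

/-- The isomorphism is the point lift. [cite: MochizukiSemiAnbd2006, Rmk 3.5.1 p.37] -/
@[simp] theorem ofSemiGraphCovering_graphIso_hom :
    (ofSemiGraphCovering_graphIso π hexc hprop).hom =
      (ofSemiGraphCovering π hexc hprop).pointLift π (fun w => ⟨w, rfl⟩) (fun e' => ⟨e', rfl⟩)
        (ofSemiGraphCovering_glueCondition π hexc hprop) :=
  rfl

/-- **`𝔾′ ≅ 𝔾_{S_π}` lies OVER `𝔾_G`.** [cite: MochizukiSemiAnbd2006, Rmk 3.5.1 p.37] -/
theorem ofSemiGraphCovering_graphIso_hom_comp :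
    (ofSemiGraphCovering_graphIso π hexc hprop).hom ≫
        (show (ofSemiGraphCovering π hexc hprop).coveringGraph.graph ⟶ K.graph
          from (ofSemiGraphCovering π hexc hprop).coveringHom.base) = π :=
  (ofSemiGraphCovering π hexc hprop).pointLift_comp_base π _ _ (ofSemiGraphCovering_glueCondition π hexc hprop)

/-- On vertices the isomorphism is `w ↦ (π w, [⟨w⟩])`. [cite: MochizukiSemiAnbd2006, §2 p.23] -/
theorem ofSemiGraphCovering_graphIso_hom_vertexMap (w : B'.Vertex) :
    (ofSemiGraphCovering_graphIso π hexc hprop).hom.vertexMap w =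
      ⟨π.vertexMap w, BTemp.cl ((ofSemiGraphCovering π hexc hprop).SV (π.vertexMap w)) ⟨w, rfl⟩⟩ := rfl

/-- On edges the isomorphism is `e′ ↦ (π e′, [⟨e′⟩])`. [cite: MochizukiSemiAnbd2006, §2 p.23] -/
theorem ofSemiGraphCovering_graphIso_hom_edgeMap (e' : B'.Edge) :
    (ofSemiGraphCovering_graphIso π hexc hprop).hom.edgeMap e' =
      ⟨π.edgeMap e', BTemp.cl ((ofSemiGraphCovering π hexc hprop).SE (π.edgeMap e')) ⟨e', rfl⟩⟩ := rfl

end CovObj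

end ProfiniteSemiGraph

end Literature.AnabelianGeometry.SemiGraphs

end
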